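import Literature.AlgebraicGeometry.ShimuraVarieties.UnitaryShimuraCurveCentralTranslate
import Mathlib.Analysis.Real.Cardinality
import Mathlib.LinearAlgebra.Countable
import HarnessLib

/-!
# Generic stabilisers on `Sh_K(U(J⋆), 𝔻)(ℂ)`: a right translation fixing an open set of one disc comes from the rational CENTRE

Topic `AlgebraicGeometry/ShimuraVarieties`; namespace `Literature.AlgebraicGeometry.ShimuraVarieties.UnitaryCanonicalModel` (the home of
★ `ShimuraSetGS`).  PROOF FILE: theorems only (three `private` 2 × 2 helpers), no definition, no instance, no named fact, no `sorry`.

THE STATEMENT (`ShimuraSetGS.exists_rational_scalar_of_forall_mk_eq`).  On `Sh_K(ℂ) = U(J⋆)(L⁺) \ [𝔻 × U(J⋆)(𝔸_{L⁺,f}) / K]`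
(★ `ShimuraSetGS`, negative vectors `v` of `J⋆^τ` up to `ℂˣ`), suppose two finite-adelic points `a, a′` satisfy `[v, aK] = [v, a′K]` for
all `v` in a non-empty OPEN set `W` of negative vectors (e.g. a right translation `T_k`, `a = a′k`, fixing an open piece of one connected
component pointwise).  Then some RATIONAL element `γ ∈ U(J⋆)(L⁺)` acting on `V⋆ ⊗_{L,τ} ℂ = ℂ²` as a SCALAR (`γ^τ = c • 1`) carries
`a′K` to `aK`.  (The sequel ★-to-be `UnitaryShimuraCurveTranslateRigidity` turns `γ` into a point of the centre `U(1)_{L/L⁺}` and concludes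
that the Hecke translate is the identity of the canonical model, [Milne2005ShimuraVarieties] Thm. 13.6: «piecewise trivial ⇒ trivial».)

THE ARGUMENT (generic stabiliser, by COUNTING).  By ★ `ShimuraSetGS.mk_eq_mk_iff` every `v ∈ W` is an eigenvector of `γ_v^τ` for some
`γ_v` in `Σ = {γ ∈ U(J⋆)(L⁺) | γ • a′K = aK}`; `Σ` is COUNTABLE (`L` is a number field, so `GL₂(L)` is countable); a NON-scalar `2 × 2`
complex matrix admits at most two parameters `t` on an affine line `v₀ + t w` (`v₀, w` independent) at which `v₀ + t w` is an
eigenvector (§1: the cross product `(M v_t) × v_t` is a quadratic in `t`; three roots kill it, and then `M` is scalar); but `W ∋ v₀` is open,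
so it contains the real segment `{v₀ + t w : |t| < ε}`, which is UNCOUNTABLE (`#(−ε, ε) = 𝔠`, Mathlib `Cardinal.mk_Ioo_real`).  Hence some
`γ ∈ Σ` is scalar.  This is the classical «the stabiliser in `G(ℚ)` of a generic point of `X` is central» step in the description of the
connected components and of the Hecke action on `Sh_K(G, X)(ℂ)` ([Milne2005ShimuraVarieties] §5, (5.1) p. 56 and Lemma 5.13 p. 57;
[Deligne1979ShimuraVarieties] 2.1.2), for the datum `G = Res U(J⋆)`.

Cell `hodgecm-mathlib` (D-0151), crux HLiu418 = stmt-HodgeConjecture-24832, d6 `stub_RosH` glue: the (L)-pen ruling 2026-08-30T06:09Z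
(«Hecke-translate rigidity is provable from the record», work order WO-HTR, step (d)).  COUNT-NEUTRAL: HC_CM is proved only modulo the 7
printed citations until rung 0 closes; nothing here mentions it.

## References
* [Milne2005ShimuraVarieties] J. S. Milne, *Introduction to Shimura varieties* (2005): §5 (5.1) p. 56, Lemma 5.13 p. 57; Thm. 13.6 p. 118.
* [Deligne1979ShimuraVarieties] P. Deligne, *Variétés de Shimura*, Proc. Symp. Pure Math. 33 (1979), 2.1.2.

Mathlib searched: `Cardinal.mk_Ioo_real`, `Cardinal.le_aleph0_iff_set_countable`, `Finsupp.Countable.of_moduleFinite`,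
`Set.Infinite.exists_subset_card_eq`, `Finset.card_eq_three` (used); no statement about generic stabilisers of arithmetic groups.
-/

set_option autoImplicit false

noncomputable section

open Function MulAction Topology NumberField CategoryTheory Matrix Cardinal IsDedekindDomain
open scoped Matrix ComplexOrder
open Literature.NumberTheory.Automorphic Literature.NumberTheory.Automorphic.UnitaryGroup

namespace Literature.AlgebraicGeometry.ShimuraVarieties.UnitaryCanonicalModel

/-! ## §1 Two-by-two linear algebra: three projectively fixed points on an affine line force a scalar -/

/-- A non-zero vector `v ∈ ℂ²` with `(M v) × v = 0` is an eigenvector of `M`. [folklore] -/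
private theorem exists_eigen_of_cross_eq_zero (M : Matrix (Fin 2) (Fin 2) ℂ) (v : Fin 2 → ℂ) (hv : v ≠ 0)
    (h : (M *ᵥ v) 0 * v 1 - (M *ᵥ v) 1 * v 0 = 0) : ∃ μ : ℂ, M *ᵥ v = μ • v := by
  rw [sub_eq_zero] at h
  by_cases h0 : v 0 = 0
  · have h1 : v 1 ≠ 0 := by
      intro h1; apply hv; funext i; fin_cases i <;> simp [h0, h1]
    refine ⟨(M *ᵥ v) 1 / v 1, funext fun i => ?_⟩
    fin_cases i
    · simp only [Pi.smul_apply, smul_eq_mul, Fin.zero_eta, Fin.isValue]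
      rw [h0, mul_zero]
      have : (M *ᵥ v) 0 * v 1 = 0 := by rw [h, h0, mul_zero]
      exact (mul_eq_zero.1 this).resolve_right h1
    · simp only [Pi.smul_apply, smul_eq_mul, Fin.mk_one, Fin.isValue]
      rw [div_mul_cancel₀ _ h1]
  · refine ⟨(M *ᵥ v) 0 / v 0, funext fun i => ?_⟩
    fin_cases i
    · simp only [Pi.smul_apply, smul_eq_mul, Fin.zero_eta, Fin.isValue]
      rw [div_mul_cancel₀ _ h0]
    · simp only [Pi.smul_apply, smul_eq_mul, Fin.mk_one, Fin.isValue]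
      rw [div_mul_eq_mul_div, eq_div_iff h0]
      exact h.symm

/-- Two eigenvectors `v, w` of `M` with the same eigenvalue and `v × w ≠ 0` make `M` scalar (Cramer: every `u` is
`((u × w) v + (v × u) w) / (v × w)`). [folklore] -/
private theorem eq_smul_one_of_eigen_pair (M : Matrix (Fin 2) (Fin 2) ℂ) (v w : Fin 2 → ℂ)
    (hD : v 0 * w 1 - v 1 * w 0 ≠ 0) (μ : ℂ) (hv : M *ᵥ v = μ • v) (hw : M *ᵥ w = μ • w) :
    M = μ • (1 : Matrix (Fin 2) (Fin 2) ℂ) := by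
  have cramer : ∀ u : Fin 2 → ℂ,
      (v 0 * w 1 - v 1 * w 0) • u = (u 0 * w 1 - u 1 * w 0) • v + (v 0 * u 1 - v 1 * u 0) • w := by
    intro u
    funext i
    fin_cases i <;> simp only [Pi.add_apply, Pi.smul_apply, smul_eq_mul, Fin.zero_eta, Fin.mk_one, Fin.isValue] <;> ring
  have key : ∀ u : Fin 2 → ℂ, M *ᵥ u = μ • u := by
    intro u
    have h1 : (v 0 * w 1 - v 1 * w 0) • (M *ᵥ u) = (v 0 * w 1 - v 1 * w 0) • (μ • u) := by
      rw [← Matrix.mulVec_smul, cramer u, Matrix.mulVec_add, Matrix.mulVec_smul, Matrix.mulVec_smul, hv, hw,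
        smul_comm (u 0 * w 1 - u 1 * w 0) μ, smul_comm (v 0 * u 1 - v 1 * u 0) μ, ← smul_add, ← cramer u, smul_comm]
    exact smul_right_injective _ hD h1
  ext i j
  have h := congrFun (key (Pi.single j 1)) i
  rw [Matrix.mulVec_single_one] at h
  change M.col j i = _ at h
  rw [show M i j = M.col j i from rfl, h, Matrix.smul_apply, Pi.smul_apply, Matrix.one_apply, Pi.single_apply]

/-- A complex quadratic `A t² + B t + C` with three distinct roots is zero. [folklore] -/
private theorem quad_coeff_eq_zero {A B C t₁ t₂ t₃ : ℂ} (h₁ : A * t₁ ^ 2 + B * t₁ + C = 0)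
    (h₂ : A * t₂ ^ 2 + B * t₂ + C = 0) (h₃ : A * t₃ ^ 2 + B * t₃ + C = 0) (h12 : t₁ ≠ t₂) (h13 : t₁ ≠ t₃)
    (h23 : t₂ ≠ t₃) : A = 0 ∧ B = 0 ∧ C = 0 := by
  have e12 : A * (t₁ + t₂) + B = 0 := by
    have : (t₁ - t₂) * (A * (t₁ + t₂) + B) = 0 := by linear_combination h₁ - h₂
    exact (mul_eq_zero.1 this).resolve_left (sub_ne_zero.2 h12)
  have e13 : A * (t₁ + t₃) + B = 0 := by
    have : (t₁ - t₃) * (A * (t₁ + t₃) + B) = 0 := by linear_combination h₁ - h₃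
    exact (mul_eq_zero.1 this).resolve_left (sub_ne_zero.2 h13)
  have hA : A = 0 := by
    have : (t₂ - t₃) * A = 0 := by linear_combination e12 - e13
    exact (mul_eq_zero.1 this).resolve_left (sub_ne_zero.2 h23)
  have hB : B = 0 := by rw [hA, zero_mul, zero_add] at e12; exact e12
  refine ⟨hA, hB, ?_⟩
  rw [hA, hB] at h₁; simpa using h₁

/-- **At most two points of an affine line `v₀ + t w` (`v₀ × w ≠ 0`) are eigenvectors of a non-scalar `2 × 2` matrix**: if
`c_k • M (v₀ + t_k w) = v₀ + t_k w` for three distinct parameters `t_k`, then `M = μ • 1`.  (The cross product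
`(M v_t) × v_t` is a quadratic in `t`; three roots make it vanish identically; its coefficients then say that `v₀`, `w` are eigenvectors
with a common eigenvalue.)  The «each non-central `γ` fixes only finitely many points of the disc» step of the generic-stabiliser argument.
[cite: Milne2005ShimuraVarieties, §5 (5.1) p. 56 and Lemma 5.13 p. 57] -/
theorem Matrix.exists_eq_smul_one_of_three_smul_mulVec_eq (M : Matrix (Fin 2) (Fin 2) ℂ) (v₀ w : Fin 2 → ℂ)
    (hD : v₀ 0 * w 1 - v₀ 1 * w 0 ≠ 0) {t₁ t₂ t₃ : ℂ} (h12 : t₁ ≠ t₂) (h13 : t₁ ≠ t₃) (h23 : t₂ ≠ t₃)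
    (h : ∀ t ∈ ({t₁, t₂, t₃} : Set ℂ), ∃ c : ℂ, c • (M *ᵥ (v₀ + t • w)) = v₀ + t • w) :
    ∃ μ : ℂ, M = μ • (1 : Matrix (Fin 2) (Fin 2) ℂ) := by
  have hroot : ∀ t ∈ ({t₁, t₂, t₃} : Set ℂ),
      ((M *ᵥ w) 0 * w 1 - (M *ᵥ w) 1 * w 0) * t ^ 2 +
        ((M *ᵥ v₀) 0 * w 1 + (M *ᵥ w) 0 * v₀ 1 - (M *ᵥ v₀) 1 * w 0 - (M *ᵥ w) 1 * v₀ 0) * t +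
          ((M *ᵥ v₀) 0 * v₀ 1 - (M *ᵥ v₀) 1 * v₀ 0) = 0 := by
    intro t ht
    obtain ⟨c, hc⟩ := h t ht
    rw [Matrix.mulVec_add, Matrix.mulVec_smul] at hc
    have e0 := congrFun hc 0
    have e1 := congrFun hc 1
    simp only [Pi.smul_apply, smul_eq_mul, Pi.add_apply] at e0 e1
    have hx : ((M *ᵥ v₀) 0 + t * (M *ᵥ w) 0) * (v₀ 1 + t * w 1) -
        ((M *ᵥ v₀) 1 + t * (M *ᵥ w) 1) * (v₀ 0 + t * w 0) = 0 := by
      linear_combination ((M *ᵥ v₀) 1 + t * (M *ᵥ w) 1) * e0 - ((M *ᵥ v₀) 0 + t * (M *ᵥ w) 0) * e1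
    linear_combination hx
  obtain ⟨hA0, hB0, hC0⟩ :=
    quad_coeff_eq_zero (hroot t₁ (by simp)) (hroot t₂ (by simp)) (hroot t₃ (by simp)) h12 h13 h23
  have hv₀ : v₀ ≠ 0 := by rintro rfl; apply hD; simp
  have hw : w ≠ 0 := by rintro rfl; apply hD; simp
  obtain ⟨μ, hμ⟩ := exists_eigen_of_cross_eq_zero M v₀ hv₀ hC0
  obtain ⟨ν, hν⟩ := exists_eigen_of_cross_eq_zero M w hw hA0
  have hμν : μ = ν := by
    have e : (μ - ν) * (v₀ 0 * w 1 - v₀ 1 * w 0) = 0 := by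
      rw [hμ, hν] at hB0
      simp only [Pi.smul_apply, smul_eq_mul] at hB0
      linear_combination hB0
    exact sub_eq_zero.1 ((mul_eq_zero.1 e).resolve_right hD)
  exact ⟨μ, eq_smul_one_of_eigen_pair M v₀ w hD μ hμ (hμν ▸ hν)⟩

/-! ## §2 `U(J⋆)(L⁺)` is countable -/

variable {L : Type} [Field L] [NumberField L] [IsCMField L] {Jstar : Matrix (Fin 2) (Fin 2) L} {τ : L →+* ℂ}

variable (L Jstar) in
/-- **The rational points `U(J⋆)(L⁺) ≤ GL₂(L)` form a countable group**: a number field is a finite-dimensional `ℚ`-vector space, hence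
countable (Mathlib `Finsupp.Countable.of_moduleFinite`), and so are `2 × 2` matrices over it and their invertible ones.
[cite: Milne2005ShimuraVarieties, §5 (5.1) p. 56] -/
theorem countable_rational : Countable ↥(rational (↥(maximalRealSubfield L)) L (IsCMField.complexConj L) 2 Jstar) := by
  haveI : Countable L := Finsupp.Countable.of_moduleFinite (R := ℚ) (M := L)
  haveI : Countable (Matrix (Fin 2) (Fin 2) L) := by unfold Matrix; infer_instance
  haveI : Countable (GL (Fin 2) L) := Function.Injective.countable (f := (Units.val : GL (Fin 2) L → _)) fun _ _ e => Units.ext e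
  infer_instance

/-! ## §3 The generic stabiliser: right translations agreeing on an open set of one disc differ by a rational scalar -/

omit [NumberField L] [IsCMField L] in
/-- A negative vector is non-zero. [cite: Milne2005ShimuraVarieties, §5 (5.1) p. 56] -/
private theorem ne_zero_of_mem_negCone {v : Fin 2 → ℂ} (hv : v ∈ negCone (Jstar.map τ)) : v ≠ 0 := by
  rintro rfl
  rw [mem_negCone_iff, Matrix.mulVec_zero, dotProduct_zero, Complex.zero_re] at hv
  exact lt_irrefl _ hv

/-- **GENERIC STABILISER on `Sh_K(U(J⋆), 𝔻)(ℂ)`.**  If `[v, aK] = [v, a′K]` for every `v` in a non-empty open set `W` of negative vectors of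
`J⋆^τ`, then there is a RATIONAL `γ ∈ U(J⋆)(L⁺)` acting on `ℂ²` as a scalar (`γ^τ = c • 1`) with `γ • a′K = aK` — each `v ∈ W` is an
eigenvector of some `γ^τ`, `γ ∈ Σ = {γ | γ • a′K = aK}` (★ `ShimuraSetGS.mk_eq_mk_iff`); `Σ ⊆ U(J⋆)(L⁺)` is countable; a non-scalar `γ^τ`
has eigenvectors at no more than two points of the segment `v₀ + t w`, `|t| < ε`, inside `W` (§1); the segment is uncountable
(`#(−ε, ε) = 𝔠`): so a scalar `γ ∈ Σ` exists.  The «stabiliser of a generic point of `X` in `G(ℚ)` is central» step of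
[Milne2005ShimuraVarieties] §5 for `G = Res U(J⋆)`. [cite: Milne2005ShimuraVarieties, §5 (5.1) p. 56 and Lemma 5.13 p. 57]
[cite: Deligne1979ShimuraVarieties, 2.1.2] -/
theorem ShimuraSetGS.exists_rational_scalar_of_forall_mk_eq
    (K : Subgroup ↥(finAdelic (↥(maximalRealSubfield L)) L (IsCMField.complexConj L) 2 Jstar))
    (a a' : ↥(finAdelic (↥(maximalRealSubfield L)) L (IsCMField.complexConj L) 2 Jstar))
    {W : Set (Fin 2 → ℂ)} (hWo : IsOpen W) (hWne : W.Nonempty) (hWsub : W ⊆ negCone (Jstar.map τ))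
    (h : ∀ (v : Fin 2 → ℂ) (hv : v ∈ W),
      ShimuraSetGS.mk L Jstar τ K v (hWsub hv) a = ShimuraSetGS.mk L Jstar τ K v (hWsub hv) a') :
    ∃ γ : ↥(rational (↥(maximalRealSubfield L)) L (IsCMField.complexConj L) 2 Jstar),
      (∃ c : ℂ, ((ratToGLℂ L Jstar τ γ : GL (Fin 2) ℂ) : Matrix (Fin 2) (Fin 2) ℂ) = c • (1 : Matrix (Fin 2) (Fin 2) ℂ)) ∧
        rationalToFinAdelic (↥(maximalRealSubfield L)) L (IsCMField.complexConj L) 2 Jstar γ •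
            ((a' : ↥(finAdelic (↥(maximalRealSubfield L)) L (IsCMField.complexConj L) 2 Jstar)) :
              ↥(finAdelic (↥(maximalRealSubfield L)) L (IsCMField.complexConj L) 2 Jstar) ⧸ K) =
          ((a : ↥(finAdelic (↥(maximalRealSubfield L)) L (IsCMField.complexConj L) 2 Jstar)) :
            ↥(finAdelic (↥(maximalRealSubfield L)) L (IsCMField.complexConj L) 2 Jstar) ⧸ K) := by
  classical
  haveI := countable_rational L Jstar
  -- the countable set of rational elements carrying `a′K` to `aK`
  set Sig : Set ↥(rational (↥(maximalRealSubfield L)) L (IsCMField.complexConj L) 2 Jstar) :=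
    {γ | rationalToFinAdelic (↥(maximalRealSubfield L)) L (IsCMField.complexConj L) 2 Jstar γ •
        ((a' : ↥(finAdelic (↥(maximalRealSubfield L)) L (IsCMField.complexConj L) 2 Jstar)) :
          ↥(finAdelic (↥(maximalRealSubfield L)) L (IsCMField.complexConj L) 2 Jstar) ⧸ K) =
      ((a : ↥(finAdelic (↥(maximalRealSubfield L)) L (IsCMField.complexConj L) 2 Jstar)) :
        ↥(finAdelic (↥(maximalRealSubfield L)) L (IsCMField.complexConj L) 2 Jstar) ⧸ K)} with hSig
  by_contra hcon
  have hns : ∀ γ ∈ Sig, ¬ ∃ c : ℂ,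
      ((ratToGLℂ L Jstar τ γ : GL (Fin 2) ℂ) : Matrix (Fin 2) (Fin 2) ℂ) = c • (1 : Matrix (Fin 2) (Fin 2) ℂ) :=
    fun γ hγ hc => hcon ⟨γ, hc, hγ⟩
  -- a base point of `W`, a ball around it inside `W`, and a second direction
  obtain ⟨v₀, hv₀W⟩ := hWne
  obtain ⟨ε, hε, hball⟩ := Metric.isOpen_iff.1 hWo v₀ hv₀W
  have hv₀ : v₀ ≠ 0 := ne_zero_of_mem_negCone (hWsub hv₀W)
  obtain ⟨w, hD⟩ : ∃ w : Fin 2 → ℂ, v₀ 0 * w 1 - v₀ 1 * w 0 ≠ 0 := by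
    by_cases h0 : v₀ 0 = 0
    · have h1 : v₀ 1 ≠ 0 := by
        intro h1; apply hv₀; funext i; fin_cases i <;> simp [h0, h1]
      exact ⟨Pi.single 0 1, by simpa [h0] using h1⟩
    · exact ⟨Pi.single 1 1, by simpa using h0⟩
  -- the real segment `v₀ + t w`, `|t| < ε′`, lies in `W`
  set ε' : ℝ := ε / (‖w‖ + 1) with hε'
  have hw1 : 0 < ‖w‖ + 1 := by positivity
  have hε'pos : 0 < ε' := div_pos hε hw1
  have hslice : ∀ t ∈ Set.Ioo (-ε') ε', v₀ + ((t : ℂ)) • w ∈ W := by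
    intro t ht
    apply hball
    rw [Metric.mem_ball, dist_eq_norm, add_sub_cancel_left, norm_smul, Complex.norm_real, Real.norm_eq_abs]
    have ht' : |t| < ε' := abs_lt.2 ht
    calc |t| * ‖w‖ ≤ |t| * (‖w‖ + 1) := by gcongr; linarith
      _ < ε' * (‖w‖ + 1) := by gcongr
      _ = ε := div_mul_cancel₀ ε hw1.ne'
  -- every parameter of the segment is explained by some `γ ∈ Σ`
  have hcover : Set.Ioo (-ε') ε' ⊆ ⋃ γ ∈ Sig,
      {t : ℝ | ∃ c : ℂ, c • (((ratToGLℂ L Jstar τ γ : GL (Fin 2) ℂ) : Matrix (Fin 2) (Fin 2) ℂ) *ᵥ (v₀ + (t : ℂ) • w)) =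
        v₀ + (t : ℂ) • w} := by
    intro t ht
    have hmk := h _ (hslice t ht)
    rw [ShimuraSetGS.mk_eq_mk_iff] at hmk
    obtain ⟨γ, c, -, hγv, hγa⟩ := hmk
    exact Set.mem_biUnion (show γ ∈ Sig from hγa) ⟨c, hγv⟩
  -- for a non-scalar `γ` at most two parameters are explained: the explained set is finite
  have hfin : ∀ γ ∈ Sig, Set.Finite
      {t : ℝ | ∃ c : ℂ, c • (((ratToGLℂ L Jstar τ γ : GL (Fin 2) ℂ) : Matrix (Fin 2) (Fin 2) ℂ) *ᵥ (v₀ + (t : ℂ) • w)) =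
        v₀ + (t : ℂ) • w} := by
    intro γ hγ
    by_contra hinf
    obtain ⟨s, hs, hs3⟩ := Set.Infinite.exists_subset_card_eq hinf 3
    obtain ⟨t₁, t₂, t₃, h12, h13, h23, rfl⟩ := Finset.card_eq_three.1 hs3
    have hmem : ∀ t ∈ ({t₁, t₂, t₃} : Finset ℝ), ∃ c : ℂ,
        c • (((ratToGLℂ L Jstar τ γ : GL (Fin 2) ℂ) : Matrix (Fin 2) (Fin 2) ℂ) *ᵥ (v₀ + (t : ℂ) • w)) = v₀ + (t : ℂ) • w :=
      fun t ht => hs (Finset.mem_coe.2 ht)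
    obtain ⟨μ, hμ⟩ := Matrix.exists_eq_smul_one_of_three_smul_mulVec_eq
      (((ratToGLℂ L Jstar τ γ : GL (Fin 2) ℂ) : Matrix (Fin 2) (Fin 2) ℂ)) v₀ w hD
      (t₁ := (t₁ : ℂ)) (t₂ := (t₂ : ℂ)) (t₃ := (t₃ : ℂ))
      (fun e => h12 (Complex.ofReal_injective e)) (fun e => h13 (Complex.ofReal_injective e))
      (fun e => h23 (Complex.ofReal_injective e)) (by
        intro t ht
        simp only [Set.mem_insert_iff, Set.mem_singleton_iff] at ht
        rcases ht with rfl | rfl | rfl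
        · exact hmem t₁ (by simp)
        · exact hmem t₂ (by simp)
        · exact hmem t₃ (by simp))
    exact hns γ hγ ⟨μ, hμ⟩
  -- so the segment is countable — absurd
  have hcount : (Set.Ioo (-ε') ε').Countable :=
    ((Set.to_countable Sig).biUnion fun γ hγ => (hfin γ hγ).countable).mono hcover
  have hle := Cardinal.le_aleph0_iff_set_countable.2 hcount
  rw [Cardinal.mk_Ioo_real (by linarith : -ε' < ε')] at hle
  exact lt_irrefl _ (Cardinal.aleph0_lt_continuum.trans_le hle)


/-! ## §4 The centre form: `aK = a′ · (x · 1₂) K` for a rational norm-one scalar `x` -/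

omit [NumberField L] [IsCMField L] in
/-- The Gram matrix of a form with a negative vector is non-zero. [cite: Milne2005ShimuraVarieties, §5 (5.1) p. 56] -/
private theorem form_ne_zero_of_mem_negCone {v : Fin 2 → ℂ} (hv : v ∈ negCone (Jstar.map τ)) : Jstar ≠ 0 := by
  rintro rfl
  rw [mem_negCone_iff, Matrix.map_zero τ (map_zero τ), Matrix.zero_mulVec, dotProduct_zero, Complex.zero_re] at hv
  exact lt_irrefl _ hv

/-- **A rational element of `U(J⋆)(L⁺)` acting on `ℂ²` as a scalar IS a rational point `x · 1₂` of the centre** (`x ∈ L`, `c(x)·x = 1`):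
`τ` is injective, so `γ = x · 1₂` in `GL₂(L)`; unitarity `c(x)·x · J⋆ = J⋆` with `J⋆ ≠ 0` gives `c(x)·x = 1` (★ `rationalCenterGS`).
[cite: Milne2005ShimuraVarieties, §5 p. 57] [cite: Mok2014, §1 Notation p. 5] -/
theorem exists_eq_rationalCenterGS_of_ratToGLℂ_eq_smul_one (hJ : Jstar ≠ 0)
    (γ : ↥(rational (↥(maximalRealSubfield L)) L (IsCMField.complexConj L) 2 Jstar)) {c : ℂ}
    (hγ : ((ratToGLℂ L Jstar τ γ : GL (Fin 2) ℂ) : Matrix (Fin 2) (Fin 2) ℂ) = c • (1 : Matrix (Fin 2) (Fin 2) ℂ)) :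
    ∃ (x : Lˣ) (hx1 : ((IsCMField.complexConj L : L ≃ₐ[↥(maximalRealSubfield L)] L) : L →+* L) (x : L) * x = 1),
      γ = rationalCenterGS Jstar x hx1 := by
  -- the matrix of `γ` over `L` is the scalar `x₀ · 1₂`, `x₀ := γ₀₀`
  set g : Matrix (Fin 2) (Fin 2) L :=
    (((γ : ↥(rational (↥(maximalRealSubfield L)) L (IsCMField.complexConj L) 2 Jstar)) : GL (Fin 2) L) :
      Matrix (Fin 2) (Fin 2) L) with hg
  have hentry : ∀ i j, τ (g i j) = (c • (1 : Matrix (Fin 2) (Fin 2) ℂ)) i j := fun i j => by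
    rw [← hγ, coe_ratToGLℂ, Matrix.map_apply]
  have hdiag : g = Matrix.diagonal fun _ => g 0 0 := by
    ext i j
    apply τ.injective
    rw [hentry, Matrix.diagonal_apply]
    by_cases hij : i = j
    · subst hij
      rw [if_pos rfl, hentry, Matrix.smul_apply, Matrix.one_apply_eq, Matrix.smul_apply, Matrix.one_apply_eq]
    · rw [if_neg hij, map_zero, Matrix.smul_apply, Matrix.one_apply_ne hij, smul_zero]
  have hx₀ : g 0 0 ≠ 0 := by
    intro h0
    have hg0 : g = 0 := by rw [hdiag, h0]; ext i j; simp [Matrix.diagonal_apply]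
    have hunit := ((γ : ↥(rational (↥(maximalRealSubfield L)) L (IsCMField.complexConj L) 2 Jstar)) : GL (Fin 2) L).mul_inv
    rw [← hg, hg0, Matrix.zero_mul] at hunit
    exact zero_ne_one hunit
  set x : Lˣ := Units.mk0 (g 0 0) hx₀ with hx
  -- unitarity of the scalar: `c(x)·x · J⋆ = J⋆`
  have hx1 : ((IsCMField.complexConj L : L ≃ₐ[↥(maximalRealSubfield L)] L) : L →+* L) (x : L) * x = 1 := by
    have hmem := (mem_unitaryGroupOfForm_iff.1 γ.2 :
      (g.map ((IsCMField.complexConj L : L ≃ₐ[↥(maximalRealSubfield L)] L) : L →+* L))ᵀ * Jstar * g = Jstar)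
    rw [← hg] at hmem
    rw [hdiag, Matrix.diagonal_map (map_zero _), Matrix.diagonal_transpose] at hmem
    have h00 : ∀ i j, ((IsCMField.complexConj L : L ≃ₐ[↥(maximalRealSubfield L)] L) : L →+* L) (g 0 0) * g 0 0 * Jstar i j =
        Jstar i j := fun i j => by
      have := congrFun (congrFun hmem i) j
      rw [Matrix.mul_diagonal, Matrix.diagonal_mul] at this
      linear_combination this
    have hne : ∃ i j, Jstar i j ≠ 0 := by
      by_contra hall
      push Not at hall
      exact hJ (Matrix.ext fun i j => hall i j)
    obtain ⟨i, j, hij⟩ := hne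
    have := h00 i j
    rw [Units.val_mk0]
    exact mul_right_cancel₀ hij (by rw [this, one_mul])
  refine ⟨x, hx1, Subtype.ext (Units.ext ?_)⟩
  rw [coe_rationalCenterGS]
  change g = _
  rw [hdiag, Units.val_mk0]

/-- **GENERIC STABILISER, CENTRE FORM** (the socket (R1) of the «Hecke-translate rigidity» chain; consumer ★-to-be
`UnitaryShimuraCurveTranslateRigidityPoints`): if `[v, aK] = [v, a′K]` for every `v` in a non-empty open set `W` of negative vectors, then
`aK = a′ · (x · 1₂) K` for a RATIONAL NORM-ONE SCALAR `x ∈ L` (`c(x)·x = 1`, read in `U(J⋆)(𝔸_{L⁺,f})` as the central element ★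
`finAdelicCenter`): §3 gives a rational `γ` with scalar `γ^τ` and `γ • a′K = aK`; §4 turns it into `x · 1₂` (★ `rationalCenterGS`,
★ `rationalToFinAdelic_rationalCenterGS`), central (★ `finAdelicCenter_mul_comm`). [cite: Milne2005ShimuraVarieties, §5 (5.1) p. 56 and Lemma 5.13 p. 57]
[cite: Deligne1979ShimuraVarieties, 2.1.2] [cite: Mok2014, §1 Notation p. 5] -/
theorem ShimuraSetGS.exists_rational_central_of_forall_mk_eq
    (K : Subgroup ↥(finAdelic (↥(maximalRealSubfield L)) L (IsCMField.complexConj L) 2 Jstar))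
    (a a' : ↥(finAdelic (↥(maximalRealSubfield L)) L (IsCMField.complexConj L) 2 Jstar))
    (W : Set (Fin 2 → ℂ)) (hWo : IsOpen W) (hWne : W.Nonempty) (hW : W ⊆ negCone (Jstar.map τ))
    (h : ∀ (v : Fin 2 → ℂ) (hv : v ∈ W), ShimuraSetGS.mk L Jstar τ K v (hW hv) a = ShimuraSetGS.mk L Jstar τ K v (hW hv) a') :
    ∃ (x : Lˣ) (hx : Units.map (algebraMap L (FiniteAdeleRing (𝓞 L) L)).toMonoidHom x ∈
        finAdelicOne (↥(maximalRealSubfield L)) L (IsCMField.complexConj L)),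
      ((a : ↥(finAdelic (↥(maximalRealSubfield L)) L (IsCMField.complexConj L) 2 Jstar)) :
          ↥(finAdelic (↥(maximalRealSubfield L)) L (IsCMField.complexConj L) 2 Jstar) ⧸ K) =
        (((a' * finAdelicCenter (↥(maximalRealSubfield L)) L (IsCMField.complexConj L) 2 Jstar ⟨_, hx⟩ :
            ↥(finAdelic (↥(maximalRealSubfield L)) L (IsCMField.complexConj L) 2 Jstar))) :
          ↥(finAdelic (↥(maximalRealSubfield L)) L (IsCMField.complexConj L) 2 Jstar) ⧸ K) := by
  obtain ⟨v₀, hv₀⟩ := hWne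
  have hJ : Jstar ≠ 0 := form_ne_zero_of_mem_negCone (hW hv₀)
  obtain ⟨γ, ⟨c, hγc⟩, hγa⟩ := ShimuraSetGS.exists_rational_scalar_of_forall_mk_eq K a a' hWo ⟨v₀, hv₀⟩ hW h
  obtain ⟨x, hx1, rfl⟩ := exists_eq_rationalCenterGS_of_ratToGLℂ_eq_smul_one hJ γ hγc
  -- `x` is a norm-one finite idèle
  have hx : Units.map (algebraMap L (FiniteAdeleRing (𝓞 L) L)).toMonoidHom x ∈
      finAdelicOne (↥(maximalRealSubfield L)) L (IsCMField.complexConj L) := by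
    rw [mem_finAdelicOne_iff]
    change conjFiniteAdele (↥(maximalRealSubfield L)) L (IsCMField.complexConj L)
        (algebraMap L (FiniteAdeleRing (𝓞 L) L) x) * algebraMap L (FiniteAdeleRing (𝓞 L) L) x = 1
    rw [← algebraMap_galConj_finiteAdele, ← map_mul, hx1, map_one]
  refine ⟨x, hx, ?_⟩
  rw [rationalToFinAdelic_rationalCenterGS x hx, Quotient.smul_coe, smul_eq_mul, finAdelicCenter_mul_comm] at hγa
  exact hγa.symm

end Literature.AlgebraicGeometry.ShimuraVarieties.UnitaryCanonicalModel

end
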